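/-
Copyright (c) 2026. All rights reserved.
Released under Apache 2.0 license as described in the file LICENSE.
Authors: abc-iut cell — seat abc-iut-L6-t15 (gen 3): proof-only companion to `HolomorphicCores`
([AbsTopIII] Prop 2.5), no new definitions.
-/
import Literature.AnabelianGeometry.AbsoluteAnabelian.ParallelogramsPlanarBasic

/-!
# Planar geometry behind [AbsTopIII] Prop 2.5, II: line segments and endpoints

Proof-only companion (no definitions) to `HolomorphicCores.lean`, continuing
`ParallelogramsPlanarBasic`.  For an open `U ⊆ ℂ` and `𝒬 = 𝒮(U)` (pre-compact squares):

* two non-degenerate closed segments with infinite intersection are collinear and their union is a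
  non-degenerate closed segment; hence the union of a STRICT CHAIN (Prop 2.5 (a)) is one;
* Prop 2.5 (a): every LINE SEGMENT of `(U, 𝒮(U))` is (the trace of) a non-degenerate closed segment
  `[a, b] ⊆ U`;
* Prop 2.5 (a): the ENDPOINTS `∂L` (points with connected complement) of such an `L` are exactly `a, b`.

Refereed classical mathematics (S. Mochizuki, *Topics in absolute anabelian geometry III*, §2; kurims
pages); nothing here bears on the disputed parts of IUT.
-/

namespace Literature.AnabelianGeometry.AbsoluteAnabelian

open _root_.Complex _root_.Set _root_.Topology _root_.Filter _root_.Metric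

noncomputable section

/-! ### Collections `𝒬` of distinguished opens with `𝒮(U) ⊆ 𝒬 ⊆ 𝒫(U)`

The algorithm of Prop 2.5 is run for `𝒬 = 𝒮(U)`, but its step (d) uses sides and line segments relative
to the RECOVERED collection `𝒫(U)`; we therefore prove the basic facts for any collection `𝒬` of subsets
of `U` containing the squares and contained in the parallelograms (hypotheses `h𝒬`, `h𝒮` below). -/

/-- `𝒮(U) ⊆ 𝒫(U)`: squares are parallelograms. [cite: MochizukiAbsTopIII2015, Proposition 2.5 p.55] -/
theorem squaresIn_subset_parallelogramsIn (U : Set ℂ) : squaresIn U ⊆ parallelogramsIn U := by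
  rintro P ⟨z, v, hv, rfl, hcl⟩
  exact ⟨z, v, I * v, linearIndependent_pair_mul_I hv, rfl, hcl⟩

/-- **Prop 2.5, the topology** (general collection): for an open `U ⊆ ℂ` and any collection `𝒬` of subsets
of `U` with `𝒮(U) ⊆ 𝒬 ⊆ 𝒫(U)`, the topology generated by `𝒬` is the subspace topology of `U`.
[cite: MochizukiAbsTopIII2015, Proposition 2.5 p.56] -/
theorem Parallelograms.topology_eq_of_subset {U : Set ℂ} (hU : IsOpen U) {𝒬 : Set (Set U)}
    (h𝒬 : ∀ Q ∈ 𝒬, Subtype.val '' Q ∈ parallelogramsIn U)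
    (h𝒮 : ∀ Q : Set U, Subtype.val '' Q ∈ squaresIn U → Q ∈ 𝒬) :
    Parallelograms.topology 𝒬 = instTopologicalSpaceSubtype := by
  refine (TopologicalSpace.IsTopologicalBasis.eq_generateFrom ?_).symm
  apply TopologicalSpace.isTopologicalBasis_of_isOpen_of_nhds
  · intro Q hQ
    obtain ⟨z, v, w, hvw, hQ', -⟩ := h𝒬 Q hQ
    rw [eq_preimage_image_val Q, hQ']
    exact (isOpen_openParallelogram hvw).preimage continuous_subtype_val
  · intro x O hxO hO
    obtain ⟨W, hW, rfl⟩ := isOpen_induced_iff.1 hO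
    have hxW : (x : ℂ) ∈ W ∩ U := ⟨hxO, x.2⟩
    obtain ⟨z, v, hv, hxP, hcl⟩ := exists_square_closure_subset (hW.inter hU) hxW
    have hPU : openParallelogram z v (I * v) ⊆ U :=
      subset_closure.trans (hcl.trans inter_subset_right)
    have himg : Subtype.val '' (Subtype.val ⁻¹' openParallelogram z v (I * v) : Set U) =
        openParallelogram z v (I * v) := by
      rw [image_preimage_eq_inter_range, Subtype.range_coe, inter_eq_left.2 hPU]
    refine ⟨Subtype.val ⁻¹' openParallelogram z v (I * v), h𝒮 _ ⟨z, v, hv, himg.symm ▸ rfl, ?_⟩,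
      hxP, ?_⟩
    · rw [himg]; exact hcl.trans inter_subset_right
    · exact preimage_mono (subset_closure.trans (hcl.trans inter_subset_left))

/-- **Prop 2.5 (a)**, strict line segments (general collection `𝒮(U) ⊆ 𝒬 ⊆ 𝒫(U)`): a strict line segment of
`(U, 𝒬)` is (the trace on `U` of) a non-degenerate closed segment.
[cite: MochizukiAbsTopIII2015, Proposition 2.5 (a) p.56] -/
theorem Parallelograms.IsStrictLineSegment.exists_eq_segment_of_subset {U : Set ℂ} (hU : IsOpen U)
    {𝒬 : Set (Set U)} (h𝒬 : ∀ Q ∈ 𝒬, Subtype.val '' Q ∈ parallelogramsIn U)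
    (h𝒮 : ∀ Q : Set U, Subtype.val '' Q ∈ squaresIn U → Q ∈ 𝒬) {L : Set U}
    (hL : Parallelograms.IsStrictLineSegment 𝒬 L) :
    ∃ a b : ℂ, a ≠ b ∧ Subtype.val '' L = segment ℝ a b := by
  obtain ⟨Q₁, hQ₁, Q₂, hQ₂, hdisj, hLeq, hinf⟩ := hL
  rw [Parallelograms.topology_eq_of_subset hU h𝒬 h𝒮] at hLeq
  obtain ⟨z₁, v₁, w₁, hv₁, hP₁, hcl₁⟩ := h𝒬 Q₁ hQ₁
  obtain ⟨z₂, v₂, w₂, hv₂, hP₂, hcl₂⟩ := h𝒬 Q₂ hQ₂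
  have key : Subtype.val '' L = closure (Subtype.val '' Q₁) ∩ closure (Subtype.val '' Q₂) := by
    rw [hLeq, image_inter Subtype.val_injective, image_val_closure_eq hcl₁, image_val_closure_eq hcl₂]
  rw [key]
  refine exists_eq_segment_closure_inter_closure ?_ ?_ ?_ ?_ ?_ ?_ ?_
  · rw [hP₁]; exact convex_openParallelogram _ _ _
  · rw [hP₁]; exact isOpen_openParallelogram hv₁
  · rw [hP₂]; exact convex_openParallelogram _ _ _
  · rw [hP₂]; exact isOpen_openParallelogram hv₂
  · exact (disjoint_image_iff Subtype.val_injective).2 (disjoint_iff_inter_eq_empty.2 hdisj)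
  · rw [hP₁]; exact isCompact_closure_openParallelogram hv₁
  · rw [← key]; exact hinf.image Subtype.val_injective.injOn

/-! ### Collinear overlapping segments -/

/-- `lineMap p q` in `ℂ` with real parameter, as a formula.
(Auxiliary.) [cite: MochizukiAbsTopIII2015, Proposition 2.5 (proof) pp.55–57] -/
theorem lineMap_apply_complex (p q : ℂ) (τ : ℝ) :
    AffineMap.lineMap p q τ = p + (τ : ℂ) * (q - p) := by
  rw [AffineMap.lineMap_apply_module, Complex.real_smul, Complex.real_smul]
  push_cast
  ring

/-- `lineMap p q` is injective for `p ≠ q`.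
(Auxiliary.) [cite: MochizukiAbsTopIII2015, Proposition 2.5 (proof) pp.55–57] -/
theorem lineMap_injective_complex {p q : ℂ} (hpq : p ≠ q) :
    Function.Injective (AffineMap.lineMap p q : ℝ → ℂ) := by
  intro σ τ h
  rw [lineMap_apply_complex, lineMap_apply_complex, add_right_inj] at h
  have hqp : q - p ≠ 0 := sub_ne_zero.2 (Ne.symm hpq)
  exact_mod_cast mul_right_cancel₀ hqp h

/-- If two distinct points `p, q` lie on the closed segment `[c, d]`, then `c` and `d` lie on the line
through `p, q`. (Auxiliary.) [cite: MochizukiAbsTopIII2015, Proposition 2.5 (proof) pp.55–57] -/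
theorem exists_lineMap_eq_of_mem_segment {c d p q : ℂ} (hp : p ∈ segment ℝ c d)
    (hq : q ∈ segment ℝ c d) (hpq : p ≠ q) :
    ∃ σ τ : ℝ, c = AffineMap.lineMap p q σ ∧ d = AffineMap.lineMap p q τ := by
  rw [segment_eq_image_lineMap] at hp hq
  obtain ⟨μ, -, rfl⟩ := hp
  obtain ⟨ν, -, rfl⟩ := hq
  have hμν : (ν : ℂ) - μ ≠ 0 := by
    intro h
    apply hpq
    have : (ν : ℝ) = μ := by exact_mod_cast sub_eq_zero.1 h
    rw [this]
  refine ⟨-μ / (ν - μ), (1 - μ) / (ν - μ), ?_, ?_⟩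
  · rw [lineMap_apply_complex, lineMap_apply_complex, lineMap_apply_complex]
    push_cast
    field_simp
    ring
  · rw [lineMap_apply_complex, lineMap_apply_complex, lineMap_apply_complex]
    push_cast
    field_simp
    ring

/-- Two non-degenerate closed segments in `ℂ` meeting in an infinite set are collinear and overlapping:
their union is a non-degenerate closed segment.
(Auxiliary.) [cite: MochizukiAbsTopIII2015, Proposition 2.5 (proof) pp.55–57] -/
theorem exists_eq_segment_union {a b c d : ℂ} (hab : a ≠ b) (hcd : c ≠ d)
    (hinf : (segment ℝ a b ∩ segment ℝ c d).Infinite) :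
    ∃ e f : ℂ, e ≠ f ∧ segment ℝ a b ∪ segment ℝ c d = segment ℝ e f := by
  obtain ⟨p, hp, q, hq, hpq⟩ := hinf.nontrivial
  set g : ℝ →ᵃ[ℝ] ℂ := AffineMap.lineMap p q with hg
  have hginj : Function.Injective g := lineMap_injective_complex hpq
  obtain ⟨α, β, ha, hb⟩ := exists_lineMap_eq_of_mem_segment hp.1 hq.1 hpq
  obtain ⟨γ, δ, hc, hd⟩ := exists_lineMap_eq_of_mem_segment hp.2 hq.2 hpq
  have hsab : segment ℝ a b = g '' uIcc α β := by rw [ha, hb, ← image_segment, segment_eq_uIcc]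
  have hscd : segment ℝ c d = g '' uIcc γ δ := by rw [hc, hd, ← image_segment, segment_eq_uIcc]
  have hαβ : α ≠ β := by rintro rfl; exact hab (by rw [ha, hb])
  have hγδ : γ ≠ δ := by rintro rfl; exact hcd (by rw [hc, hd])
  have hp0 : g 0 = p := by rw [hg, AffineMap.lineMap_apply_zero]
  have h0ab : (0 : ℝ) ∈ uIcc α β := by
    have : p ∈ g '' uIcc α β := hsab ▸ hp.1
    obtain ⟨θ, hθ, hθp⟩ := this
    rwa [← hginj (hθp.trans hp0.symm)]
  have h0cd : (0 : ℝ) ∈ uIcc γ δ := by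
    have : p ∈ g '' uIcc γ δ := hscd ▸ hp.2
    obtain ⟨θ, hθ, hθp⟩ := this
    rwa [← hginj (hθp.trans hp0.symm)]
  simp only [uIcc, mem_Icc] at h0ab h0cd
  have hunion : uIcc α β ∪ uIcc γ δ = Icc (min (min α β) (min γ δ)) (max (max α β) (max γ δ)) := by
    rw [uIcc, uIcc, Icc_union_Icc' (h0cd.1.trans h0ab.2) (h0ab.1.trans h0cd.2)]
  have hmM : min (min α β) (min γ δ) < max (max α β) (max γ δ) :=
    (min_le_left _ _).trans_lt ((min_lt_max.2 hαβ).trans_le (le_max_left _ _))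
  refine ⟨g (min (min α β) (min γ δ)), g (max (max α β) (max γ δ)),
    fun h => hmM.ne (hginj h), ?_⟩
  rw [hsab, hscd, ← image_union, hunion, ← segment_eq_Icc hmM.le, image_segment]

/-- The union of a non-empty list of non-degenerate closed segments in `ℂ`, consecutive ones meeting
in infinite sets (a "strict chain"), is a non-degenerate closed segment.
(Auxiliary.) [cite: MochizukiAbsTopIII2015, Proposition 2.5 (a) p.56] -/
theorem exists_eq_segment_of_chain :
    ∀ (c : List (Set ℂ)), c ≠ [] → (∀ M ∈ c, ∃ a b : ℂ, a ≠ b ∧ M = segment ℝ a b) →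
      List.IsChain (fun M M' => (M ∩ M').Infinite) c →
        ∃ a b : ℂ, a ≠ b ∧ (⋃ M ∈ c, M) = segment ℝ a b
  | [], h, _, _ => (h rfl).elim
  | [M], _, hM, _ => by
    obtain ⟨a, b, hab, rfl⟩ := hM M (by simp)
    exact ⟨a, b, hab, by simp⟩
  | M :: M' :: rest, _, hM, hc => by
    obtain ⟨a, b, hab, rfl⟩ := hM M (by simp)
    rw [List.isChain_cons_cons] at hc
    obtain ⟨e, f, hef, hU⟩ := exists_eq_segment_of_chain (M' :: rest) (by simp)
      (fun N hN => hM N (List.mem_cons_of_mem _ hN)) hc.2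
    have hM'sub : M' ⊆ segment ℝ e f := by
      rw [← hU]; exact subset_biUnion_of_mem (u := fun N : Set ℂ => N) List.mem_cons_self
    obtain ⟨a', b', hab', hU'⟩ :=
      exists_eq_segment_union hab hef (hc.1.mono (inter_subset_inter_right _ hM'sub))
    refine ⟨a', b', hab', ?_⟩
    rw [← hU', ← hU]
    simp only [List.mem_cons, iUnion_iUnion_eq_or_left]

/-! ### Prop 2.5 (a): line segments are segments -/

/-- **Prop 2.5 (a)**, line segments (general collection `𝒮(U) ⊆ 𝒬 ⊆ 𝒫(U)`): every line segment of
`(U, 𝒬)` ("the union of the strict line segments contained in a strict chain") is (the trace on `U` of) a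
non-degenerate closed segment `[a, b]`, which lies in `U`. [cite: MochizukiAbsTopIII2015, Proposition 2.5 (a) p.56] -/
theorem Parallelograms.IsLineSegment.exists_eq_segment_of_subset {U : Set ℂ} (hU : IsOpen U)
    {𝒬 : Set (Set U)} (h𝒬 : ∀ Q ∈ 𝒬, Subtype.val '' Q ∈ parallelogramsIn U)
    (h𝒮 : ∀ Q : Set U, Subtype.val '' Q ∈ squaresIn U → Q ∈ 𝒬) {L : Set U}
    (hL : Parallelograms.IsLineSegment 𝒬 L) :
    ∃ a b : ℂ, a ≠ b ∧ Subtype.val '' L = segment ℝ a b := by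
  obtain ⟨c, ⟨hlen, hstrict, hchain⟩, rfl⟩ := hL
  rw [image_iUnion₂]
  have hne : c.map (Subtype.val '' ·) ≠ [] := by
    intro h
    rw [List.map_eq_nil_iff] at h
    simp [h] at hlen
  obtain ⟨a, b, hab, hU'⟩ := exists_eq_segment_of_chain (c.map (Subtype.val '' ·)) hne
    (fun N hN => by
      obtain ⟨M, hM, rfl⟩ := List.mem_map.1 hN
      exact (hstrict M hM).exists_eq_segment_of_subset hU h𝒬 h𝒮)
    (List.isChain_map _ |>.2 (hchain.imp fun M M' h => by
      show (Subtype.val '' M ∩ Subtype.val '' M').Infinite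
      rw [← image_inter Subtype.val_injective]
      exact h.image Subtype.val_injective.injOn))
  refine ⟨a, b, hab, ?_⟩
  rw [← hU']
  ext x
  simp only [mem_iUnion, List.mem_map, exists_prop]
  constructor
  · rintro ⟨M, hM, hx⟩
    exact ⟨_, ⟨M, hM, rfl⟩, hx⟩
  · rintro ⟨_, ⟨M, hM, rfl⟩, hx⟩
    exact ⟨M, hM, hx⟩

/-- **Prop 2.5 (a)**, line segments of `(U, 𝒮(U))` are non-degenerate closed segments.
[cite: MochizukiAbsTopIII2015, Proposition 2.5 (a) p.56] -/
theorem Parallelograms.IsLineSegment.exists_eq_segment {U : Set ℂ} (hU : IsOpen U) {L : Set U}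
    (hL : Parallelograms.IsLineSegment {Q : Set U | Subtype.val '' Q ∈ squaresIn U} L) :
    ∃ a b : ℂ, a ≠ b ∧ Subtype.val '' L = segment ℝ a b :=
  hL.exists_eq_segment_of_subset hU (fun _ hQ => squaresIn_subset_parallelogramsIn U hQ) fun _ h => h

/-! ### Prop 2.5 (a): endpoints -/

/-- The real coordinate along the segment `[a, b]`: a continuous functional `ℓ` with `ℓ (a + τ (b - a)) = τ`.
(Auxiliary.) [cite: MochizukiAbsTopIII2015, Proposition 2.5 (proof) pp.55–57] -/
theorem exists_leftInverse_lineMap {a b : ℂ} (hab : a ≠ b) :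
    ∃ ℓ : ℂ → ℝ, Continuous ℓ ∧ ∀ τ : ℝ, ℓ (AffineMap.lineMap a b τ) = τ := by
  have hn : Complex.normSq (b - a) ≠ 0 := by
    rw [ne_eq, Complex.normSq_eq_zero]; exact sub_ne_zero.2 (Ne.symm hab)
  refine ⟨fun z => ((z - a) * (starRingEnd ℂ) (b - a)).re / Complex.normSq (b - a), by fun_prop,
    fun τ => ?_⟩
  dsimp only
  rw [lineMap_apply_complex, add_sub_cancel_left, mul_assoc, Complex.mul_conj, ← Complex.ofReal_mul,
    Complex.ofReal_re, mul_div_assoc, div_self hn, mul_one]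

/-- Removing a point `y` from a non-degenerate closed segment `[a, b] ⊆ ℂ` leaves a connected set iff `y`
is one of the two ends. (Auxiliary.) [cite: MochizukiAbsTopIII2015, Proposition 2.5 (a) p.56] -/
theorem isConnected_segment_diff_singleton_iff {a b y : ℂ} (hab : a ≠ b) (hy : y ∈ segment ℝ a b) :
    IsConnected (segment ℝ a b \ {y}) ↔ y = a ∨ y = b := by
  have hginj := lineMap_injective_complex hab
  have hgc : Continuous (AffineMap.lineMap a b : ℝ → ℂ) := by
    have : (AffineMap.lineMap a b : ℝ → ℂ) = fun τ : ℝ => a + (τ : ℂ) * (b - a) :=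
      funext (lineMap_apply_complex a b)
    rw [this]; fun_prop
  rw [segment_eq_image_lineMap] at hy ⊢
  obtain ⟨θ, hθ, rfl⟩ := hy
  rw [← image_singleton, ← image_sdiff hginj]
  constructor
  · intro hconn
    by_contra hne
    have h0 : θ ≠ 0 := fun h => hne (Or.inl (by rw [h, AffineMap.lineMap_apply_zero]))
    have h1 : θ ≠ 1 := fun h => hne (Or.inr (by rw [h, AffineMap.lineMap_apply_one]))
    obtain ⟨ℓ, hℓc, hℓ⟩ := exists_leftInverse_lineMap hab
    have himg : ℓ '' (AffineMap.lineMap a b '' (Icc (0 : ℝ) 1 \ {θ})) = Icc (0 : ℝ) 1 \ {θ} := by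
      rw [image_image]
      simp only [hℓ, image_id']
    have hpre : IsPreconnected (Icc (0 : ℝ) 1 \ {θ}) :=
      himg ▸ (hconn.image ℓ hℓc.continuousOn).isPreconnected
    have hmem := hpre.Icc_subset (a := 0) (b := 1) ⟨⟨le_rfl, zero_le_one⟩, Ne.symm h0⟩
      ⟨⟨zero_le_one, le_rfl⟩, Ne.symm h1⟩ hθ
    exact hmem.2 rfl
  · rintro (h | h)
    · have hθ0 : θ = 0 := hginj (by rw [h, AffineMap.lineMap_apply_zero])
      rw [hθ0, Icc_sdiff_left]
      exact (isConnected_Ioc zero_lt_one).image _ hgc.continuousOn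
    · have hθ1 : θ = 1 := hginj (by rw [h, AffineMap.lineMap_apply_one])
      rw [hθ1, Icc_sdiff_right]
      exact (isConnected_Ico zero_lt_one).image _ hgc.continuousOn

/-- Connectedness of a subset of the subtype `U` is connectedness of its image in `ℂ`.
(Auxiliary.) [cite: MochizukiAbsTopIII2015, Proposition 2.5 (proof) pp.55–57] -/
theorem isConnected_iff_image_val {U : Set ℂ} {s : Set U} :
    IsConnected s ↔ IsConnected (Subtype.val '' s) :=
  ⟨fun h => h.image _ continuous_subtype_val.continuousOn, fun h =>
    ⟨image_nonempty.1 h.nonempty, Topology.IsInducing.subtypeVal.isPreconnected_image.1 h.2⟩⟩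

/-- **Prop 2.5 (a)**, endpoints (general collection `𝒮(U) ⊆ 𝒬 ⊆ 𝒫(U)`): for `L ⊆ U` the trace of a
non-degenerate closed segment `[a, b]`, the endpoints `∂L` — the points of `L` "whose complement in `L` is
connected" — are exactly `a` and `b`. [cite: MochizukiAbsTopIII2015, Proposition 2.5 (a) p.56] -/
theorem Parallelograms.endpoints_eq_of_subset {U : Set ℂ} (hU : IsOpen U) {𝒬 : Set (Set U)}
    (h𝒬 : ∀ Q ∈ 𝒬, Subtype.val '' Q ∈ parallelogramsIn U)
    (h𝒮 : ∀ Q : Set U, Subtype.val '' Q ∈ squaresIn U → Q ∈ 𝒬) {L : Set U}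
    {a b : ℂ} (hab : a ≠ b) (hL : Subtype.val '' L = segment ℝ a b) :
    Parallelograms.endpoints 𝒬 L = L ∩ Subtype.val ⁻¹' {a, b} := by
  unfold Parallelograms.endpoints
  rw [Parallelograms.topology_eq_of_subset hU h𝒬 h𝒮]
  ext x
  simp only [mem_setOf_eq, mem_inter_iff, mem_preimage, mem_insert_iff, mem_singleton_iff]
  refine and_congr_right fun hx => ?_
  rw [isConnected_iff_image_val, image_sdiff Subtype.val_injective, image_singleton, hL]
  exact isConnected_segment_diff_singleton_iff hab (hL ▸ mem_image_of_mem _ hx)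

/-- **Prop 2.5 (a)**, endpoints, image form (general collection): `∂L = {a, b}` as a subset of `ℂ`.
[cite: MochizukiAbsTopIII2015, Proposition 2.5 (a) p.56] -/
theorem Parallelograms.image_val_endpoints_eq_of_subset {U : Set ℂ} (hU : IsOpen U) {𝒬 : Set (Set U)}
    (h𝒬 : ∀ Q ∈ 𝒬, Subtype.val '' Q ∈ parallelogramsIn U)
    (h𝒮 : ∀ Q : Set U, Subtype.val '' Q ∈ squaresIn U → Q ∈ 𝒬) {L : Set U}
    {a b : ℂ} (hab : a ≠ b) (hL : Subtype.val '' L = segment ℝ a b) :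
    Subtype.val '' Parallelograms.endpoints 𝒬 L = {a, b} := by
  rw [Parallelograms.endpoints_eq_of_subset hU h𝒬 h𝒮 hab hL, image_inter_preimage, hL]
  refine inter_eq_right.2 (insert_subset_iff.2 ⟨left_mem_segment ℝ a b, ?_⟩)
  rw [singleton_subset_iff]; exact right_mem_segment ℝ a b

/-- **Prop 2.5 (a)**, endpoints for `𝒬 = 𝒮(U)`: `∂L = {a, b}`.
[cite: MochizukiAbsTopIII2015, Proposition 2.5 (a) p.56] -/
theorem Parallelograms.image_val_endpoints_eq {U : Set ℂ} (hU : IsOpen U) {L : Set U}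
    {a b : ℂ} (hab : a ≠ b) (hL : Subtype.val '' L = segment ℝ a b) :
    Subtype.val '' Parallelograms.endpoints {Q : Set U | Subtype.val '' Q ∈ squaresIn U} L = {a, b} :=
  Parallelograms.image_val_endpoints_eq_of_subset hU
    (fun _ hQ => squaresIn_subset_parallelogramsIn U hQ) (fun _ h => h) hab hL

end

end Literature.AnabelianGeometry.AbsoluteAnabelian
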